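import Mathlib
import HarnessLib
import Summits.NavierStokesRegularity.FunctionalMining.NoGo.TwoNotchVacuumPhaseLock

/-!
# TwoNotchSiblingLock — the SIBLING LOCK of the permissive two-notch P-book (p = 1): consecutive births at M whose members die as
sibling pairs and host nothing have the same level and opposite chirality (STAGING; census-2 g26, METHODS (dd.102)/(dd.102a),
pen text `pub-nsfunc-census-2/exact/perm-B/lock/SCRIPT-LOCK-B.md` §2)

search for candidate a priori estimates; no regularity claim

STAGING ONLY (for the prove seat to place — suggested target `Summits/NavierStokesRegularity/FunctionalMining/NoGo/TwoNotchSiblingLock.lean`,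
kind proof, no defs — or discard; census-2 files nothing in the tree itself). Companion of the tree module
`NoGo/TwoNotchVacuumPhaseLock.lean` (nogo g18, p297202; countersigned by census-2 in METHODS (dd.101c)), which it imports for `gapRatio` and
`gapRatio_eq_iff` only (disclosed reuse): that file locks two consecutive VACUUM EPISODES; this one drops the vacuum — the second pair may be
born and travel while the first is alive, other chords and t-hosted events may exist elsewhere, nothing is periodic — because the four meal
equations lose every height (K1–K3 below) once the combinatorial LEMMA F of the pen text has supplied its two facts: the second meal is P's next
meal after the first, and mid(P) between the meals = mid(M) between the births (signed-content conservation on the arc from M to P; the two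
arithmetic identities behind it are K8a/K8b). LEMMA F itself is pen-proved and machine-asserted pair by pair on 815 282 cycle classes
(SCRIPT-LOCK-B.md §5), not kernel-checked — exactly as the kinematic reading of `TwoNotchVacuumPhaseLock` is a prose dictionary there.

DICTIONARY (prose; the hypotheses of the theorems below are what the pen proof extracts from a lawful history with S1–S3):
* universal cover of the circle of circumference 1, x to the right, height y upward; a chord with mid-state μ moves on a straight line of
  slope `v = −T μ` between the events it takes part in (velocity locality);
* `M` (main −d) sits on the line `Λ(y) = X + V (y − s₁)` for `y ∈ [s₁, s₂]` = between its two consecutive births b (height s₁) and b′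
  (height s₂), `V = −T m`, m = mid(M) on (b, b′);
* `P` (main +d) sits on the line `Π(y) = Λ(y) + h` for `y ∈ [t₁, t₂]` = between the two sibling meals e (height t₁) and e′ (height t₂): SAME
  slope `V` by LEMMA F (v); `h` is the rightward offset of P's lift over M's line; NO order between t₁ and s₂ is assumed;
* the pair born at b starts at `Λ(s₁) = X`; its right member r (velocity `vr₁`) meets P's lift `Π` at height t₁ and its left member ℓ
  (velocity `vl₁`) meets the lift `Π − 1` at the same height (sibling meal e across the circle); the pair born at b′ starts at `Λ(s₂)` and
  does the same at height t₂ (meal e′); members run straight because they host nothing (S3);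
* with M's mid `m` on (b, b′): right-member mid of the first pair `μ₁ = m − d/2 + ε₁ a₁/2`, of the second pair `μ₂ = m − d/2 − ε₂ a₂/2`
  (ε = +1 for chirality A = (−a | M | +a), −1 for B; a = level size, 0 < a < d; the second is read off M's post-b′ mid m − ε₂ a₂),
  left-member mid = right-member mid + d.
Nothing here is about Navier–Stokes; it is a statement about the toy chord gas of the K-functional programme.
-/

namespace Summit.NavierStokesRegularity.FunctionalMining.TwoNotchSiblingLock

open Summit.NavierStokesRegularity.FunctionalMining.TwoNotchVacuumPhaseLock

/-! ## K1–K2. The four meal equations lose every height: both pairs see the same offset `h` -/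

/-- K1 (sibling meal identity, first pair): lifetime·(vr − vl) = 1 and `h·(vr − vl) = vr − V`. -/
theorem pair_one (X V h s₁ t₁ vr vl : ℝ)
    (hr : X + vr * (t₁ - s₁) = X + V * (t₁ - s₁) + h)
    (hl : X + vl * (t₁ - s₁) = X + V * (t₁ - s₁) + h - 1) :
    (vr - vl) * (t₁ - s₁) = 1 ∧ h * (vr - vl) = vr - V := by
  have hτ : (vr - vl) * (t₁ - s₁) = 1 := by linarith
  refine ⟨hτ, ?_⟩
  have hh : h = (vr - V) * (t₁ - s₁) := by linarith
  rw [hh]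
  calc (vr - V) * (t₁ - s₁) * (vr - vl) = (vr - V) * ((vr - vl) * (t₁ - s₁)) := by ring
    _ = vr - V := by rw [hτ, mul_one]

/-- K2 (second pair, born LATER on M's line at height s₂ and eaten while P is still on the parallel line):
the same offset `h` satisfies `h·(vr − vl) = vr − V` with the second pair's velocities — the birth height `s₂`
and both meal heights drop out (this is the step where "e before b′" is NOT needed: s₂ < t₁ is allowed). -/
theorem pair_two (X V h s₁ s₂ t₂ vr vl : ℝ)
    (hr : (X + V * (s₂ - s₁)) + vr * (t₂ - s₂) = X + V * (t₂ - s₁) + h)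
    (hl : (X + V * (s₂ - s₁)) + vl * (t₂ - s₂) = X + V * (t₂ - s₁) + h - 1) :
    (vr - vl) * (t₂ - s₂) = 1 ∧ h * (vr - vl) = vr - V := by
  have hτ : (vr - vl) * (t₂ - s₂) = 1 := by linarith
  refine ⟨hτ, ?_⟩
  have hh : h = (vr - V) * (t₂ - s₂) := by linarith
  rw [hh]
  calc (vr - V) * (t₂ - s₂) * (vr - vl) = (vr - V) * ((vr - vl) * (t₂ - s₂)) := by ring
    _ = vr - V := by rw [hτ, mul_one]

/-- K3: hence the two gap ratios agree: `(vr₁ − V)/(vr₁ − vl₁) = (vr₂ − V)/(vr₂ − vl₂)`. -/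
theorem gap_ratios_agree (X V h s₁ t₁ s₂ t₂ vr₁ vl₁ vr₂ vl₂ : ℝ)
    (hr₁ : X + vr₁ * (t₁ - s₁) = X + V * (t₁ - s₁) + h)
    (hl₁ : X + vl₁ * (t₁ - s₁) = X + V * (t₁ - s₁) + h - 1)
    (hr₂ : (X + V * (s₂ - s₁)) + vr₂ * (t₂ - s₂) = X + V * (t₂ - s₁) + h)
    (hl₂ : (X + V * (s₂ - s₁)) + vl₂ * (t₂ - s₂) = X + V * (t₂ - s₁) + h - 1) :
    (vr₁ - V) / (vr₁ - vl₁) = (vr₂ - V) / (vr₂ - vl₂) := by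
  obtain ⟨hτ₁, h₁⟩ := pair_one X V h s₁ t₁ vr₁ vl₁ hr₁ hl₁
  obtain ⟨hτ₂, h₂⟩ := pair_two X V h s₁ s₂ t₂ vr₂ vl₂ hr₂ hl₂
  have hc₁ : vr₁ - vl₁ ≠ 0 := by
    intro h0; rw [h0, zero_mul] at hτ₁; exact zero_ne_one hτ₁
  have hc₂ : vr₂ - vl₂ ≠ 0 := by
    intro h0; rw [h0, zero_mul] at hτ₂; exact zero_ne_one hτ₂
  rw [div_eq_iff hc₁, div_mul_eq_mul_div, eq_div_iff hc₂]
  calc (vr₁ - V) * (vr₂ - vl₂) = (h * (vr₁ - vl₁)) * (vr₂ - vl₂) := by rw [h₁]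
    _ = (h * (vr₂ - vl₂)) * (vr₁ - vl₁) := by ring
    _ = (vr₂ - V) * (vr₁ - vl₁) := by rw [h₂]

/-! ## K4. With the velocity law `v = −T(mid)` the common value is a gap ratio at M's mid `m` -/

/-- K4: `(vr − V)/(vr − vl)` with `vr = −T μ`, `vl = −T (μ + d)`, `V = −T m` is `gapRatio T m d μ`. -/
theorem ratio_eq_gapRatio (T : ℝ → ℝ) (m d μ : ℝ) :
    (-T μ - -T m) / (-T μ - -T (μ + d)) = gapRatio T m d μ := by
  unfold gapRatio
  have e1 : -T μ - -T m = T m - T μ := by ring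
  have e2 : -T μ - -T (μ + d) = T (μ + d) - T μ := by ring
  rw [e1, e2]

/-! ## K5. THE LOCK: same level, opposite chirality (any law strictly increasing on a band, any tilt) -/

/-- K5 (SIBLING LOCK, kinematic form).  Two consecutive M-births with sibling meals that are consecutive P-events, members
hosting nothing, and mid(P) between the meals = mid(M) = `m` between the births (so both hosts have velocity `−T m`):
the four meal equations force `a₂ = a₁` and `ε₂ = −ε₁` (same level, opposite chirality).  `I` ⊇ `[m − d, m + d]` is a band
on which the law `T` is strictly increasing. -/
theorem sibling_lock {T : ℝ → ℝ} {I : Set ℝ} (hT : StrictMonoOn T I)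
    (m d a₁ a₂ ε₁ ε₂ X h s₁ t₁ s₂ t₂ : ℝ)
    (ha₁ : 0 < a₁) (ha₁d : a₁ < d) (ha₂ : 0 < a₂) (ha₂d : a₂ < d)
    (hε₁ : ε₁ = 1 ∨ ε₁ = -1) (hε₂ : ε₂ = 1 ∨ ε₂ = -1)
    (hI : Set.Icc (m - d) (m + d) ⊆ I)
    (hr₁ : X + (-T (m - d/2 + ε₁ * a₁/2)) * (t₁ - s₁) = X + (-T m) * (t₁ - s₁) + h)
    (hl₁ : X + (-T (m - d/2 + ε₁ * a₁/2 + d)) * (t₁ - s₁) = X + (-T m) * (t₁ - s₁) + h - 1)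
    (hr₂ : (X + (-T m) * (s₂ - s₁)) + (-T (m - d/2 - ε₂ * a₂/2)) * (t₂ - s₂) = X + (-T m) * (t₂ - s₁) + h)
    (hl₂ : (X + (-T m) * (s₂ - s₁)) + (-T (m - d/2 - ε₂ * a₂/2 + d)) * (t₂ - s₂) = X + (-T m) * (t₂ - s₁) + h - 1) :
    a₂ = a₁ ∧ ε₂ = -ε₁ := by
  set μ₁ := m - d/2 + ε₁ * a₁/2 with hμ₁
  set μ₂ := m - d/2 - ε₂ * a₂/2 with hμ₂
  have key := gap_ratios_agree X (-T m) h s₁ t₁ s₂ t₂ (-T μ₁) (-T (μ₁ + d)) (-T μ₂) (-T (μ₂ + d)) hr₁ hl₁ hr₂ hl₂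
  rw [ratio_eq_gapRatio, ratio_eq_gapRatio] at key
  -- the band: μ ∈ (m − d, m), i.e. |ε a| < d
  have hb₁ : -d < ε₁ * a₁ ∧ ε₁ * a₁ < d := by
    rcases hε₁ with h1 | h1 <;> subst h1 <;> constructor <;> linarith
  have hb₂ : -d < ε₂ * a₂ ∧ ε₂ * a₂ < d := by
    rcases hε₂ with h2 | h2 <;> subst h2 <;> constructor <;> linarith
  have hμ : μ₁ = μ₂ := by
    have := (gapRatio_eq_iff hT m d μ₁ μ₂
      (hI ⟨by linarith [hb₁.1], by linarith [hb₁.2]⟩) (hI ⟨by linarith [hb₂.1], by linarith [hb₂.2]⟩)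
      (hI ⟨by linarith, by linarith⟩)
      (hI ⟨by linarith [hb₁.1], by linarith [hb₁.2]⟩) (hI ⟨by linarith [hb₂.1], by linarith [hb₂.2]⟩)
      (by linarith [hb₁.2]) (by linarith [hb₁.1]) (by linarith [hb₂.1]) (by linarith [hb₂.2])).mp key
    exact this
  have hεa : ε₁ * a₁ = -(ε₂ * a₂) := by
    have : m - d/2 + ε₁ * a₁/2 = m - d/2 - ε₂ * a₂/2 := hμ
    linarith
  rcases hε₁ with h1 | h1 <;> rcases hε₂ with h2 | h2 <;> subst h1 <;> subst h2
  · exfalso; linarith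
  · constructor <;> linarith
  · constructor <;> linarith
  · exfalso; linarith

/-- K5′ (no content in the compatible case): with `a₂ = a₁` and `ε₂ = −ε₁` the two right-member mids coincide, so the
second pair asks for exactly the offset the first pair left — the lock is vacuous for an alternating same-level word
(the clockworks of the census), whatever the heights. -/
theorem compatible_mids_coincide (m d a ε : ℝ) :
    m - d/2 + ε * a/2 = m - d/2 - (-ε) * a/2 := by ring

/-! ## K6. The registered special case (dd.102): SCRIPT LOCK = sibling lock with the second birth after the first meal
(`t₁ ≤ s₂`); recorded as an instance to make the logical dependence explicit — the order of `t₁` and `s₂` is never used. -/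
/-- SCRIPT LOCK = the sibling lock with the second birth after the first meal (registered special case (dd.102); see the section comment). [census-2; bookkeeping] -/
theorem script_lock {T : ℝ → ℝ} {I : Set ℝ} (hT : StrictMonoOn T I)
    (m d a₁ a₂ ε₁ ε₂ X h s₁ t₁ s₂ t₂ : ℝ)
    (ha₁ : 0 < a₁) (ha₁d : a₁ < d) (ha₂ : 0 < a₂) (ha₂d : a₂ < d)
    (hε₁ : ε₁ = 1 ∨ ε₁ = -1) (hε₂ : ε₂ = 1 ∨ ε₂ = -1)
    (hI : Set.Icc (m - d) (m + d) ⊆ I)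
    (_horder : t₁ ≤ s₂)
    (hr₁ : X + (-T (m - d/2 + ε₁ * a₁/2)) * (t₁ - s₁) = X + (-T m) * (t₁ - s₁) + h)
    (hl₁ : X + (-T (m - d/2 + ε₁ * a₁/2 + d)) * (t₁ - s₁) = X + (-T m) * (t₁ - s₁) + h - 1)
    (hr₂ : (X + (-T m) * (s₂ - s₁)) + (-T (m - d/2 - ε₂ * a₂/2)) * (t₂ - s₂) = X + (-T m) * (t₂ - s₁) + h)
    (hl₂ : (X + (-T m) * (s₂ - s₁)) + (-T (m - d/2 - ε₂ * a₂/2 + d)) * (t₂ - s₂) = X + (-T m) * (t₂ - s₁) + h - 1) :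
    a₂ = a₁ ∧ ε₂ = -ε₁ :=
  sibling_lock hT m d a₁ a₂ ε₁ ε₂ X h s₁ t₁ s₂ t₂ ha₁ ha₁d ha₂ ha₂d hε₁ hε₂ hI hr₁ hl₁ hr₂ hl₂

/-! ## K7. The model law `T = tan` -/

/-- K7: the sibling lock for `tan` as soon as the band `[m − d, m + d]` lies inside `(−π/2, π/2)`. -/
theorem tan_sibling_lock (m d a₁ a₂ ε₁ ε₂ X h s₁ t₁ s₂ t₂ : ℝ)
    (ha₁ : 0 < a₁) (ha₁d : a₁ < d) (ha₂ : 0 < a₂) (ha₂d : a₂ < d)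
    (hε₁ : ε₁ = 1 ∨ ε₁ = -1) (hε₂ : ε₂ = 1 ∨ ε₂ = -1)
    (hlo : -(Real.pi / 2) < m - d) (hhi : m + d < Real.pi / 2)
    (hr₁ : X + (-Real.tan (m - d/2 + ε₁ * a₁/2)) * (t₁ - s₁) = X + (-Real.tan m) * (t₁ - s₁) + h)
    (hl₁ : X + (-Real.tan (m - d/2 + ε₁ * a₁/2 + d)) * (t₁ - s₁) = X + (-Real.tan m) * (t₁ - s₁) + h - 1)
    (hr₂ : (X + (-Real.tan m) * (s₂ - s₁)) + (-Real.tan (m - d/2 - ε₂ * a₂/2)) * (t₂ - s₂) = X + (-Real.tan m) * (t₂ - s₁) + h)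
    (hl₂ : (X + (-Real.tan m) * (s₂ - s₁)) + (-Real.tan (m - d/2 - ε₂ * a₂/2 + d)) * (t₂ - s₂) = X + (-Real.tan m) * (t₂ - s₁) + h - 1) :
    a₂ = a₁ ∧ ε₂ = -ε₁ :=
  sibling_lock Real.strictMonoOn_tan m d a₁ a₂ ε₁ ε₂ X h s₁ t₁ s₂ t₂ ha₁ ha₁d ha₂ ha₂d hε₁ hε₂
    (fun x hx => ⟨by linarith [hx.1], by linarith [hx.2]⟩) hr₁ hl₁ hr₂ hl₂

/-! ## K8. The bookkeeping behind LEMMA F (v) (mid inheritance) in its arithmetic form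

States around the circle are partial sums of signed chord sizes.  Reading the word rightward from M (drop d) across the
arc B with signed content `SB` to P (rise d): `mid P − mid M = SB` at one height.  Between the first birth b and its meal e
the mid of M moves by the sum `σ` of the shifts of the M-births in (b, e) (each shift = −(signed size of that birth's
right member)), so `mid P(e⁺) − mid M(b⁺) = SB(e⁺) + σ =: D`; LEMMA F (v) of the pen text is `D = 0` (there: the arc behind the first right member
evolves from empty through M-births and through events whose signed content is zero).  Recorded as the trivial identities they are. -/

/-- K8a: crossing M (size d, read as a drop) then an arc of signed content `SB` then P (a rise d): mid P − mid M = SB. -/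
theorem midP_sub_midM (L d SB : ℝ) :
    let midM := (L + (L - d)) / 2          -- states L | M | L − d
    let leftP := (L - d) + SB              -- state just left of P
    let midP := (leftP + (leftP + d)) / 2  -- states leftP | P | leftP + d
    midP - midM = SB := by
  intro midM leftP midP
  simp only [midM, leftP, midP]; ring

/-- K8b: a birth of a pair (ℓ, r) with signed sizes (−ρ, ρ) adjacent to M shifts mid M by −ρ and keeps M's drop d. -/
theorem birth_shift (L d ρ : ℝ) :
    let midM := (L + (L - d)) / 2                    -- before: L | M | L − d
    let midM' := ((L + -ρ) + (L - d - ρ)) / 2         -- after:  L | ℓ(−ρ) | L − ρ | M | L − d − ρ | r(+ρ) | L − d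
    midM' - midM = -ρ ∧ (L + -ρ) - (L - d - ρ) = d := by
  intro midM midM'
  simp only [midM, midM']; constructor <;> ring

end Summit.NavierStokesRegularity.FunctionalMining.TwoNotchSiblingLock
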